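import Mathlib
import HarnessLib
import Summits.Ventures.LatticeQCDFlow.Exactness.U1MultiStepLeapfrogHMCErgodic
import Summits.Ventures.LatticeQCDFlow.Exactness.U1FTHMCErgodic

/-!
# Field-transformed multi-step leapfrog HMC on `U(1)` lattice gauge fields: exact at every `nstep`, uniformly ergodic for short trajectories

HONEST FRAMING: exact (Metropolis-corrected) sampling algorithms for lattice gauge theory;
figures of merit are autocorrelation/cost numbers at stated couplings and volumes; no
continuum-physics claim.

Venture `LatticeQCDFlow` (cell pub-lqcd), topic `Exactness`, FANOUT row 9 (eng-latcore; the kernel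
family B's `latflow.fthmc` runs on the `U(1)` rung: HMC in trivialized variables `V = F⁻¹(U)` for
the pulled-back action `S∘F − log J`, `nstep` leapfrog steps, reported through `F`).  NEW WORK of
the cell over the tree (`U1MultiStepLeapfrogHMCErgodic.lean`: Doeblin for `u1LeapfrogHMCN` under
`4·Lip(g)·ε·n² ≤ 3`; `U1FTHMCErgodic.lean`: `abs_pulledBackAction_le`, the `nstep = 1` twin;
`TransformedKernelConvergence.conjKernel_minorised`; `MomentumRefresh.thmc_config_exact`); nothing
here is cited as a fact.  Printed counterpart, named only: Lüscher 2010 (trivializing maps / THMC).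

* `u1LeapfrogFTHMCN_invariant` (+ `_gibbsLaw`) — the REPORTED kernel
  `F ∘ K_n(S∘F − log J) ∘ F⁻¹` leaves `e^{−S}·Haar^{⊗ι}` invariant at EVERY `nstep`, for every
  measurable equivalence `F` of `U(1)^ι` with `HasJacobian Haar^{⊗ι} F J`, `J > 0` measurable, every
  measurable `S` and increment `g`, `κ > 0` (`thmc_config_exact`);
* **`u1LeapfrogFTHMCN_uniformlyErgodic`**, **`u1LeapfrogFTHMCN_invariant_unique`** — if moreover
  `0 < j₁ ≤ J ≤ j₂`, `|S| ≤ s`, and the increment used in the trivialized variables (in the engine: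
  `−½ε ∂_V(S∘F − log J)`, or any other rule) is measurable, `K`-Lipschitz, bounded by `b ≥ 0` with
  `4 K ε n² ≤ 3` (`ε > 0`, `n ≥ 1`): `|μ₀K̃_nᵗ(A) − π_S(A)| ≤ (1 − δ)ᵗ` for some `δ ∈ (0, 1]`, every
  initial law, `t`, `A`; `π_S` is the unique invariant probability law.

NOT CLAIMED: longer trajectories; a Lipschitz constant for the pulled-back force of a particular
flow member (the masked `U(1)` LO sub-step's would follow from `U1WilsonForceLipschitz` and the
layer formulas — not computed); OMF words; `SU(N)`; any useful rate; floating point.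
-/

noncomputable section

namespace Summit.Ventures.LatticeQCDFlow.Exactness

open MeasureTheory ProbabilityTheory ProbabilityTheory.Kernel Set
open Literature.MathematicalPhysics.QuantumFieldTheory
open scoped ENNReal NNReal

section FTHMC

variable {ι : Type*} [Fintype ι] {ε κ : ℝ} {g : (ι → Circle) → ι → ℝ} {b : ℝ} {n : ℕ} {K : ℝ≥0}
  {S : (ι → Circle) → ℝ} {s : ℝ} {F : (ι → Circle) ≃ᵐ (ι → Circle)} {J : (ι → Circle) → ℝ} {j₁ j₂ : ℝ}

/-- **The reported `U(1)` FT-HMC kernel is exact at every `nstep`**: `n`-step leapfrog HMC for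
`S∘F − log J`, reported through `F`, leaves `e^{−S}·Haar^{⊗ι}` invariant (`thmc_config_exact`). -/
theorem u1LeapfrogFTHMCN_invariant (hκ : 0 < κ) (hg : Measurable g) (hJ : ∀ v, 0 < J v)
    (hJm : Measurable J)
    (hF : HasJacobian (Measure.pi fun _ : ι => haarProbability Circle) F fun v => ENNReal.ofReal (J v))
    (hS : Measurable S) (n : ℕ) :
    Invariant (conjKernel (u1LeapfrogHMCN ε κ hg (fun v => S (F v) - Real.log (J v)) n) F)
      ((Measure.pi fun _ : ι => haarProbability Circle).withDensity
        fun u => ENNReal.ofReal (Real.exp (-S u))) :=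
  thmc_config_exact (vol := Measure.pi fun _ : ι => haarProbability Circle)
    (volP := volume) (hΦ := measurable_u1LeapfrogProposalN ε n hg) hJ hJm hF hS (measurable_u1Kinetic κ)
    (involutive_u1LeapfrogProposalN ε n) (measurePreserving_u1LeapfrogProposalN ε n hg)
    (u1MomentumWeight_univ_ne_zero hκ) (u1MomentumWeight_univ_ne_top hκ)

/-- … and the normalised Gibbs law `π_S` is invariant. -/
theorem u1LeapfrogFTHMCN_invariant_gibbsLaw (hκ : 0 < κ) (hg : Measurable g) (hJ : ∀ v, 0 < J v)
    (hJm : Measurable J)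
    (hF : HasJacobian (Measure.pi fun _ : ι => haarProbability Circle) F fun v => ENNReal.ofReal (J v))
    (hS : Measurable S) (n : ℕ) :
    Invariant (conjKernel (u1LeapfrogHMCN ε κ hg (fun v => S (F v) - Real.log (J v)) n) F)
      (u1GibbsLaw S) :=
  invariant_smul (u1LeapfrogFTHMCN_invariant hκ hg hJ hJm hF hS n) _

/-- **FIELD-TRANSFORMED `n`-STEP LEAPFROG HMC ON `U(1)^ι` IS UNIFORMLY ERGODIC FOR SHORT
TRAJECTORIES**: pinched certified Jacobian `0 < j₁ ≤ J ≤ j₂`, measurable `|S| ≤ s`, the increment in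
trivialized variables measurable, `K`-Lipschitz, bounded by `b ≥ 0`, `4 K ε n² ≤ 3`, `ε, κ > 0`,
`n ≥ 1`. -/
theorem u1LeapfrogFTHMCN_uniformlyErgodic (hε : 0 < ε) (hκ : 0 < κ) (hn : 1 ≤ n)
    (hg : Measurable g) (hgK : LipschitzWith K g) (hshort : 4 * (K : ℝ) * ε * (n : ℝ) ^ 2 ≤ 3)
    (hb0 : 0 ≤ b) (hb : ∀ u l, ‖g u l‖ ≤ b) (hS : Measurable S) (hs : ∀ u, |S u| ≤ s)
    (hj₁ : 0 < j₁) (hJ₁ : ∀ v, j₁ ≤ J v) (hJ₂ : ∀ v, J v ≤ j₂) (hJm : Measurable J)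
    (hF : HasJacobian (Measure.pi fun _ : ι => haarProbability Circle) F fun v => ENNReal.ofReal (J v)) :
    ∃ δ : ℝ, 0 < δ ∧ δ ≤ 1 ∧ ∀ (μ₀ : Measure (ι → Circle)) [IsProbabilityMeasure μ₀] (t : ℕ)
      (A : Set (ι → Circle)),
      |((fun m : Measure (ι → Circle) =>
            m.bind (conjKernel (u1LeapfrogHMCN ε κ hg (fun v => S (F v) - Real.log (J v)) n) F))^[t]
              μ₀).real A
          - (u1GibbsLaw S).real A| ≤ (1 - δ) ^ t := by
  haveI : Fact (0 < κ) := ⟨hκ⟩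
  haveI := isProbabilityMeasure_u1GibbsLaw (ι := ι) hs
  have hJ : ∀ v, 0 < J v := fun v => hj₁.trans_le (hJ₁ v)
  have hSt : Measurable fun v : ι → Circle => S (F v) - Real.log (J v) :=
    (hS.comp F.measurable).sub (Real.measurable_log.comp hJm)
  obtain ⟨δ, hδ0, hmin⟩ := u1LeapfrogHMCN_minorised hε hκ hn hg hgK hshort hb0 hb hSt
    (abs_pulledBackAction_le hs hj₁ hJ₁ hJ₂)
  have hmin' := fun x => conjKernel_minorised hmin F x
  have hH : Measurable fun z : (ι → Circle) × (ι → ℝ) =>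
      (S (F z.1) - Real.log (J z.1)) + u1Kinetic κ z.2 :=
    (hSt.comp measurable_fst).add ((measurable_u1Kinetic κ).comp measurable_snd)
  haveI : Fact (Measurable fun z : (ι → Circle) × (ι → ℝ) =>
      (S (F z.1) - Real.log (J z.1)) + u1Kinetic κ z.2) := ⟨hH⟩
  haveI : IsMarkovKernel (u1LeapfrogHMCN ε κ hg (fun v => S (F v) - Real.log (J v)) n) := by
    unfold u1LeapfrogHMCN; infer_instance
  haveI : IsProbabilityMeasure ((Measure.pi fun _ : ι => haarProbability Circle).map F) :=
    Measure.isProbabilityMeasure_map F.measurable.aemeasurable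
  have hδ1 : δ ≤ 1 := by
    have h := Measure.le_iff'.1 (hmin fun _ => 1) univ
    rwa [Measure.smul_apply, smul_eq_mul, measure_univ, measure_univ, mul_one] at h
  have hδtop : δ ≠ ⊤ := ne_top_of_le_ne_top ENNReal.one_ne_top hδ1
  refine ⟨δ.toReal, ENNReal.toReal_pos hδ0.ne' hδtop,
    ENNReal.toReal_le_of_le_ofReal zero_le_one (by rwa [ENNReal.ofReal_one]), fun μ₀ _ t A => ?_⟩
  exact uniformlyErgodic_of_minorised hmin'
    (u1LeapfrogFTHMCN_invariant_gibbsLaw hκ hg hJ hJm hF hS n) μ₀ t A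

/-- **The Gibbs law is the unique invariant probability law of the reported `n`-step `U(1)` FT-HMC
kernel** (same hypotheses). -/
theorem u1LeapfrogFTHMCN_invariant_unique (hε : 0 < ε) (hκ : 0 < κ) (hn : 1 ≤ n)
    (hg : Measurable g) (hgK : LipschitzWith K g) (hshort : 4 * (K : ℝ) * ε * (n : ℝ) ^ 2 ≤ 3)
    (hb0 : 0 ≤ b) (hb : ∀ u l, ‖g u l‖ ≤ b) (hS : Measurable S) (hs : ∀ u, |S u| ≤ s)
    (hj₁ : 0 < j₁) (hJ₁ : ∀ v, j₁ ≤ J v) (hJ₂ : ∀ v, J v ≤ j₂) (hJm : Measurable J)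
    (hF : HasJacobian (Measure.pi fun _ : ι => haarProbability Circle) F fun v => ENNReal.ofReal (J v))
    {π' : Measure (ι → Circle)} [IsProbabilityMeasure π']
    (hπ' : Invariant (conjKernel (u1LeapfrogHMCN ε κ hg (fun v => S (F v) - Real.log (J v)) n) F) π') :
    π' = u1GibbsLaw S := by
  haveI : Fact (0 < κ) := ⟨hκ⟩
  haveI := isProbabilityMeasure_u1GibbsLaw (ι := ι) hs
  have hJ : ∀ v, 0 < J v := fun v => hj₁.trans_le (hJ₁ v)
  have hSt : Measurable fun v : ι → Circle => S (F v) - Real.log (J v) :=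
    (hS.comp F.measurable).sub (Real.measurable_log.comp hJm)
  obtain ⟨δ, hδ0, hmin⟩ := u1LeapfrogHMCN_minorised hε hκ hn hg hgK hshort hb0 hb hSt
    (abs_pulledBackAction_le hs hj₁ hJ₁ hJ₂)
  have hmin' := fun x => conjKernel_minorised hmin F x
  haveI : Fact (Measurable fun z : (ι → Circle) × (ι → ℝ) =>
      (S (F z.1) - Real.log (J z.1)) + u1Kinetic κ z.2) :=
    ⟨(hSt.comp measurable_fst).add ((measurable_u1Kinetic κ).comp measurable_snd)⟩
  haveI : IsMarkovKernel (u1LeapfrogHMCN ε κ hg (fun v => S (F v) - Real.log (J v)) n) := by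
    unfold u1LeapfrogHMCN; infer_instance
  haveI : IsProbabilityMeasure ((Measure.pi fun _ : ι => haarProbability Circle).map F) :=
    Measure.isProbabilityMeasure_map F.measurable.aemeasurable
  exact invariant_unique_of_minorised hmin' hδ0
    (u1LeapfrogFTHMCN_invariant_gibbsLaw hκ hg hJ hJm hF hS n) hπ'

end FTHMC

end Summit.Ventures.LatticeQCDFlow.Exactness
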